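import Literature.AlgebraicGeometry.Motives.HodgeStructureCentralizerPrimitiveCentralIdempotents
import Literature.AlgebraicGeometry.Motives.HodgeStructureCentralizerInvolutionFieldExtension
import HarnessLib

/-!
# FIRST KIND, `K`-POINTS: `S₀(A)(K) = Z(S(H)(K)) ≅ {±1}^{MaxSpec(C₀ ⊗ K)}` AS A GROUP, ACTING ON `V₁ ⊕ ⋯ ⊕ V_{t_K}` THROUGH ITS SIGN
# VECTOR — Milne's `S₀(A)(R) = {γ ∈ C₀(A) ⊗_ℚ R | γ†γ = 1}` for a field `R = K` on whose centre `†` is trivial: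
# `μ₂(F₁ × ⋯ × F_{t_K}) = {±1}^{t_K}` «together with their actions on `V(A)`» (Milne 1999 §1 p. 645, Prop. 1.7, Remark 1.6; §2 L1–L3, p. 646)

[topic AlgebraicGeometry/Motives]

Layer `Literature/AlgebraicGeometry/Motives`, lane `lit-hodgefound` (Track 2 foundations library; prover seat
`lit-hodgefound-p02`, generation 56, self-proposed row g56-#10). THEOREMS ONLY: no definition, no named fact (net debt `0`),
no instance, no notation.  g55-#1 proved `Z(S(H)(ℚ)) ≃* ({canonical ℚ-blocks} → ℤˣ)` for `†` of the first kind; g55-#8 COUNTED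
`#Z(S(H)(K)) = 2^{t_K}` for every field `K ⊇ ℚ`; g56-#7 supplied the `K`-blocks: the primitive central idempotents `(e_𝔪)_{𝔪 ∈ MaxSpec Z_K}`
of `C(H)(K)`, `K ⊗ V = ⊕_𝔪 e_𝔪(K ⊗ V)`, and the dichotomy «a central `γ` is `+1` or `−1` on each block».  PROVED here (polarized
`(H, ψ)` on a finite-dimensional `V`, `†` of the first kind, any field `K ⊇ ℚ`, any primitive family `(e_𝔪)`):
**an isomorphism of groups `σ : Z(S(H)(K)) ≃* (MaxSpec Z_K → ℤˣ)` with `γ v = σ(γ)(𝔪) · v` for `v ∈ e_𝔪(K ⊗ V)`** — the sign is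
well defined because every block is non-zero and `K` has characteristic `0`; `σ` is a homomorphism because the blocks are
`S(H)(K)`-stable; injective because `K ⊗ V = ⊕ e_𝔪(K ⊗ V)`; surjective because `γ = 1 − 2 Σ_{ε(𝔪) = −1} e_𝔪` is a central element of
`S(H)(K)` (g55-#13) with sign vector `ε`.

## The sources, verbatim

* J. S. Milne, *Lefschetz classes on abelian varieties*, Duke Math. J. 96 (1999) 639–675 [Milne1999LefschetzClasses] (held
  `paper:doi-10-1215-s0012-7094-99-09620-5`): folio 7 = p. 645 L2–L14 «let `C₀(A)` be the centre of the `ℚ`-algebra `End⁰(A)` — it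
  is a product of fields, each of which is either a CM-field or `ℚ`. Every Rosati involution `†` preserves each factor of `C₀(A)` and
  acts on it as complex conjugation. … `S₀(A)(R) = {γ ∈ C₀(A) ⊗_ℚ R | γ†γ = 1}`. Proposition 1.7. … an isomorphism of algebraic
  groups `S₀(A)_{/ℚ_ℓ} → S_ℓ(A)`»; folio 6 Remark 1.6; §2 L1–L3 «We wish to calculate `C(A)` and `S(A)`, together with their actions
  on `V(A)`»; folio 8 = p. 646 L33–L38 («`1 = e₁ + ⋯ + e_t` … `V(A) = V₁ ⊕ ⋯ ⊕ V_t`, `V_i = e_i V`»).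
* B. J. J. Moonen, Yu. G. Zarhin, *Weil classes on abelian varieties* [MoonenZarhin1998WeilClasses], §1 Lemma (1) («in all other cases
  it is finite»).
* H. Lange, *Abelian Varieties over the Complex Numbers* (2023) [Lange2023AbelianVarietiesComplex], §2.6.2 Lemma 2.6.4 (first kind).

Nearest tree results, BY NAME: g56-#7 `Polarization.forall_apply_eq_or_forall_apply_eq_neg_of_mem_center`,
`isInternal_range_primitive_central_idempotents`, `completeOrthogonalIdempotents_primitive_central_idempotents`,
`apply_mem_range_of_mem_center_centralizer`; g55-#13 `Polarization.exists_mem_center_lefschetzGroupBaseChange_coe_eq_one_sub_of_isIdempotentElem`;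
g56-#4 `Polarization.coe_mem_centralizer_endAlg_baseChange`; g55-#1 (`K = ℚ`), g55-#8 (`#Z(S(H)(K)) = 2^{t_K}`).

## Dictionary and what is proved (namespace `Literature.AlgebraicGeometry.Motives.HodgeStructure`)

`S(H)(K) = ψ.lefschetzGroupBaseChange K`, `Z_K = Subalgebra.center K C(H)(K)`, "`(e_𝔪)` primitive" as in g56-#7, signs `ℤˣ` acting by
`((ε : ℤˣ) : ℤ) • v`; the `Fintype (MaxSpec Z_K)` instance is arbitrary.

* `exists_mem_range_ne_zero_of_primitive` (every block `e_𝔪(K ⊗ V)` is non-zero),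
  **`Polarization.exists_center_lefschetzGroupBaseChange_mulEquiv_signVector`** (`Z(S(H)(K)) ≃* (MaxSpec Z_K → ℤˣ)`, `γ = σ(γ)(𝔪)` on
  `e_𝔪(K ⊗ V)`).
-/

noncomputable section

open scoped TensorProduct

namespace Literature.AlgebraicGeometry.Motives

namespace HodgeStructure

universe u v

section SignVector

variable (K : Type u) [Field K] [Algebra ℚ K] {V : Type v} [AddCommGroup V] [Module ℚ V] [Module.Finite ℚ V] {n : ℤ}
  {H : HodgeStructure V n} (ψ : Polarization H)

omit [Module.Finite ℚ V] in
/-- In a `K`-space (`K ⊇ ℚ`): if `ε • v = ε' • v` for signs `ε, ε' ∈ ℤˣ` and some `v ≠ 0`, then `ε = ε'`. [folklore] -/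
private theorem units_int_eq_of_smul_eq₅₇₀ {ε ε' : ℤˣ} {v : K ⊗[ℚ] V} (hv : v ≠ 0) (h : ((ε : ℤ) • v : K ⊗[ℚ] V) = (ε' : ℤ) • v) :
    ε = ε' := by
  have h2K : (2 : K) ≠ 0 := by
    rw [← map_ofNat (algebraMap ℚ K) 2]
    exact (map_ne_zero _).2 two_ne_zero
  have hvv : v + v ≠ 0 := by
    rw [← two_smul K v]
    exact smul_ne_zero h2K hv
  rcases Int.units_eq_one_or ε with rfl | rfl <;> rcases Int.units_eq_one_or ε' with rfl | rfl
  · rfl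
  · exfalso
    rw [Units.val_one, one_zsmul, Units.val_neg, Units.val_one, neg_one_zsmul, eq_neg_iff_add_eq_zero] at h
    exact hvv h
  · exfalso
    rw [Units.val_one, one_zsmul, Units.val_neg, Units.val_one, neg_one_zsmul, neg_eq_iff_add_eq_zero] at h
    exact hvv h
  · rfl

set_option maxSynthPendingDepth 4 in
omit [Module.Finite ℚ V] in
/-- **EVERY BLOCK `e_𝔪(K ⊗ V)` IS NON-ZERO** (`e_𝔪 ≠ 0` as `e_𝔪 ∉ 𝔪`). [cite: Milne1999LefschetzClasses, §2 p. 646 L33–L38] -/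
theorem exists_mem_range_ne_zero_of_primitive
    {e : MaximalSpectrum (Subalgebra.center K (Subalgebra.centralizer K
          ((fun a : Module.End ℚ V => a.baseChange K) '' (H.endAlg : Set (Module.End ℚ V))))) →
        Subalgebra.center K (Subalgebra.centralizer K
          ((fun a : Module.End ℚ V => a.baseChange K) '' (H.endAlg : Set (Module.End ℚ V))))}
    (he : ∀ I, IsIdempotentElem (e I) ∧ e I ∉ I.asIdeal ∧ ∀ J, J ≠ I → e I ∈ J.asIdeal)
    (I : MaximalSpectrum (Subalgebra.center K (Subalgebra.centralizer K
          ((fun a : Module.End ℚ V => a.baseChange K) '' (H.endAlg : Set (Module.End ℚ V)))))) :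
    ∃ v ∈ LinearMap.range ((e I).1.1 : Module.End K (K ⊗[ℚ] V)), v ≠ 0 := by
  by_contra h
  push Not at h
  apply (he I).2.1
  have h0 : e I = 0 := by
    refine Subtype.ext (Subtype.ext (LinearMap.ext fun w => ?_))
    exact h _ (LinearMap.mem_range_self _ w)
  rw [h0]
  exact I.asIdeal.zero_mem

set_option maxSynthPendingDepth 4 in
/-- **FIRST KIND, `K`-POINTS: `Z(S(A)(K)) = S₀(K) ≅ {±1}^{MaxSpec(C₀ ⊗ K)}` AS A GROUP, ACTING ON `V₁ ⊕ ⋯ ⊕ V_{t_K}` BY ITS SIGN VECTOR** —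
an isomorphism `σ : Z(S(H)(K)) ≃* (MaxSpec Z_K → ℤˣ)` with `γ v = σ(γ)(𝔪) · v` on the block `e_𝔪(K ⊗ V)` (polarizable `H`, `†` of the
first kind, `(e_𝔪)` the primitive central idempotents of `C(H)(K)`).  Milne's `S₀(A)(R) = {γ ∈ C₀(A) ⊗ R | γ†γ = 1}` for a field
`R = K` on which `†` is trivial: `μ₂(F₁ × ⋯ × F_{t_K}) = {±1}^{t_K}` «together with their actions on `V(A)`» (g55-#1 is `K = ℚ` with the
canonical `ℚ`-blocks; g55-#8 counted `#Z(S(H)(K)) = 2^{t_K}`). Injective: a central `γ` trivial on every block is trivial on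
`K ⊗ V = ⊕ e_𝔪(K ⊗ V)` (g56-#7); surjective: `γ = 1 − 2 Σ_{ε(𝔪) = −1} e_𝔪` (g55-#13). [cite: Milne1999LefschetzClasses, §1 p. 645 L2–L14 (S₀, Prop. 1.7), §2 L1–L3 and p. 646 L33–L38]
[cite: MoonenZarhin1998WeilClasses, §1 Lemma (1)] -/
theorem Polarization.exists_center_lefschetzGroupBaseChange_mulEquiv_signVector
    (hfix : ∀ z : H.endAlg, z ∈ Subalgebra.center ℚ H.endAlg → ψ.adjoint (z : Module.End ℚ V) = z)
    [Fintype (MaximalSpectrum (Subalgebra.center K (Subalgebra.centralizer K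
      ((fun a : Module.End ℚ V => a.baseChange K) '' (H.endAlg : Set (Module.End ℚ V))))))]
    [DecidableEq (MaximalSpectrum (Subalgebra.center K (Subalgebra.centralizer K
      ((fun a : Module.End ℚ V => a.baseChange K) '' (H.endAlg : Set (Module.End ℚ V))))))]
    {e : MaximalSpectrum (Subalgebra.center K (Subalgebra.centralizer K
          ((fun a : Module.End ℚ V => a.baseChange K) '' (H.endAlg : Set (Module.End ℚ V))))) →
        Subalgebra.center K (Subalgebra.centralizer K
          ((fun a : Module.End ℚ V => a.baseChange K) '' (H.endAlg : Set (Module.End ℚ V))))}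
    (he : ∀ I, IsIdempotentElem (e I) ∧ e I ∉ I.asIdeal ∧ ∀ J, J ≠ I → e I ∈ J.asIdeal) :
    ∃ σ : Subgroup.center (ψ.lefschetzGroupBaseChange K) ≃*
        (MaximalSpectrum (Subalgebra.center K (Subalgebra.centralizer K
          ((fun a : Module.End ℚ V => a.baseChange K) '' (H.endAlg : Set (Module.End ℚ V))))) → ℤˣ),
      ∀ (γ : Subgroup.center (ψ.lefschetzGroupBaseChange K)) I,
        ∀ v ∈ LinearMap.range ((e I).1.1 : Module.End K (K ⊗[ℚ] V)),
          ((γ : ψ.lefschetzGroupBaseChange K) : (K ⊗[ℚ] V) ≃ₗ[K] (K ⊗[ℚ] V)) v = ((σ γ I : ℤˣ) : ℤ) • v := by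
  have hH : H.IsPolarizable := ⟨ψ⟩
  -- the sign of a central `γ` on the block `e_𝔪(K ⊗ V)`
  have hsign : ∀ (γ : Subgroup.center (ψ.lefschetzGroupBaseChange K)) (I : MaximalSpectrum (Subalgebra.center K
      (Subalgebra.centralizer K ((fun a : Module.End ℚ V => a.baseChange K) '' (H.endAlg : Set (Module.End ℚ V)))))),
      ∃ ε : ℤˣ, ∀ v ∈ LinearMap.range ((e I).1.1 : Module.End K (K ⊗[ℚ] V)),
        ((γ : ψ.lefschetzGroupBaseChange K) : (K ⊗[ℚ] V) ≃ₗ[K] (K ⊗[ℚ] V)) v = ((ε : ℤˣ) : ℤ) • v := by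
    intro γ I
    rcases ψ.forall_apply_eq_or_forall_apply_eq_neg_of_mem_center K hfix he γ.2 I with h | h
    · exact ⟨1, fun v hv => by rw [h v hv, Units.val_one, one_zsmul]⟩
    · exact ⟨-1, fun v hv => by rw [h v hv, Units.val_neg, Units.val_one, neg_one_zsmul]⟩
  choose σ hσ using hsign
  -- uniqueness of the sign on a (non-zero) block
  have huniq : ∀ (I : MaximalSpectrum (Subalgebra.center K (Subalgebra.centralizer K
      ((fun a : Module.End ℚ V => a.baseChange K) '' (H.endAlg : Set (Module.End ℚ V)))))) (ε ε' : ℤˣ),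
      (∀ v ∈ LinearMap.range ((e I).1.1 : Module.End K (K ⊗[ℚ] V)), ((ε : ℤ) • v : K ⊗[ℚ] V) = (ε' : ℤ) • v) → ε = ε' := by
    intro I ε ε' h
    obtain ⟨v, hv, hv0⟩ := exists_mem_range_ne_zero_of_primitive K he I
    exact units_int_eq_of_smul_eq₅₇₀ K hv0 (h v hv)
  -- blocks are stable under `S(H)(K)`
  have hstab : ∀ (δ : ψ.lefschetzGroupBaseChange K) (I : MaximalSpectrum (Subalgebra.center K (Subalgebra.centralizer K
      ((fun a : Module.End ℚ V => a.baseChange K) '' (H.endAlg : Set (Module.End ℚ V)))))),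
      ∀ v ∈ LinearMap.range ((e I).1.1 : Module.End K (K ⊗[ℚ] V)),
        ((δ : (K ⊗[ℚ] V) ≃ₗ[K] (K ⊗[ℚ] V)) v) ∈ LinearMap.range ((e I).1.1 : Module.End K (K ⊗[ℚ] V)) :=
    fun δ I v hv => (apply_mem_range_of_mem_center_centralizer K (e I)).1 _ (ψ.coe_mem_centralizer_endAlg_baseChange K δ) v hv
  have hortho := (completeOrthogonalIdempotents_primitive_central_idempotents K hH he).1.toOrthogonalIdempotents
  -- `σ` as a monoid homomorphism
  let f : Subgroup.center (ψ.lefschetzGroupBaseChange K) →*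
      (MaximalSpectrum (Subalgebra.center K (Subalgebra.centralizer K
        ((fun a : Module.End ℚ V => a.baseChange K) '' (H.endAlg : Set (Module.End ℚ V))))) → ℤˣ) :=
    { toFun := σ,
      map_one' := funext fun I => huniq I _ _ fun v hv => by
        rw [← hσ 1 I v hv, Pi.one_apply, Units.val_one, one_zsmul]
        rfl,
      map_mul' := fun γ δ => funext fun I => huniq I _ _ fun v hv => by
        rw [← hσ (γ * δ) I v hv, Pi.mul_apply, Units.val_mul, ← smul_smul, ← hσ δ I v hv,
          ← hσ γ I _ (hstab (δ : ψ.lefschetzGroupBaseChange K) I v hv)]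
        rfl }
  have hf : ∀ γ, f γ = σ γ := fun γ => rfl
  -- injective: a central `γ` which is `+1` on every block is `1` on `K ⊗ V = ⊕ e_𝔪(K ⊗ V)`
  have hinj : Function.Injective f := by
    refine (injective_iff_map_eq_one f).2 fun γ hγ1 => ?_
    have htop := (isInternal_range_primitive_central_idempotents K hH he).submodule_iSup_eq_top
    refine Subtype.ext (Subtype.ext (LinearEquiv.ext fun x => ?_))
    have hx : x ∈ ⨆ I, LinearMap.range ((e I).1.1 : Module.End K (K ⊗[ℚ] V)) := by
      rw [htop]
      exact Submodule.mem_top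
    change ((γ : ψ.lefschetzGroupBaseChange K) : (K ⊗[ℚ] V) ≃ₗ[K] (K ⊗[ℚ] V)) x = x
    induction hx using Submodule.iSup_induction' with
    | mem I v hv =>
      have h1 : ((σ γ I : ℤˣ) : ℤ) = 1 := by
        rw [← hf, hγ1, Pi.one_apply, Units.val_one]
      rw [hσ γ I v hv, h1, one_zsmul]
    | zero => exact map_zero _
    | add x y _ _ hx hy => rw [map_add, hx, hy]
  -- surjective: `γ = 1 − 2 Σ_{ε(𝔪) = −1} e_𝔪`
  have hsurj : Function.Surjective f := by
    intro ε
    let T := Finset.univ.filter fun I : MaximalSpectrum (Subalgebra.center K (Subalgebra.centralizer K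
      ((fun a : Module.End ℚ V => a.baseChange K) '' (H.endAlg : Set (Module.End ℚ V))))) => ε I = -1
    have hu : IsIdempotentElem (∑ I ∈ T, e I) := hortho.isIdempotentElem_sum
    obtain ⟨γ, hγc, hγu⟩ := ψ.exists_mem_center_lefschetzGroupBaseChange_coe_eq_one_sub_of_isIdempotentElem K hfix hu
    refine ⟨⟨γ, hγc⟩, funext fun I => huniq I _ _ fun v hv => ?_⟩
    rw [hf, ← hσ ⟨γ, hγc⟩ I v hv]
    obtain ⟨w, rfl⟩ := hv
    -- `(Σ_{J ∈ T} e_J) e_𝔪 = e_𝔪` or `0`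
    have hue : (∑ J ∈ T, e J) * e I = if I ∈ T then e I else 0 := by
      rw [Finset.sum_mul]
      simp_rw [hortho.mul_eq]
      exact Finset.sum_ite_eq' T I e
    have hγv : ((γ : (K ⊗[ℚ] V) ≃ₗ[K] (K ⊗[ℚ] V)) : Module.End K (K ⊗[ℚ] V)) ((e I).1.1 w) =
        (e I).1.1 w - ((((∑ J ∈ T, e J) * e I).1.1 : Module.End K (K ⊗[ℚ] V)) w +
          (((∑ J ∈ T, e J) * e I).1.1 : Module.End K (K ⊗[ℚ] V)) w) := by
      rw [hγu]
      rfl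
    change ((γ : (K ⊗[ℚ] V) ≃ₗ[K] (K ⊗[ℚ] V)) : Module.End K (K ⊗[ℚ] V)) ((e I).1.1 w) = _
    rw [hγv, hue]
    rcases Int.units_eq_one_or (ε I) with h1 | h1
    · have hI : I ∉ T := by
        rw [Finset.mem_filter]
        rintro ⟨-, h2⟩
        rw [h1] at h2
        exact absurd h2 (by decide)
      rw [if_neg hI, h1, Units.val_one, one_zsmul]
      change (e I).1.1 w - ((0 : Module.End K (K ⊗[ℚ] V)) w + (0 : Module.End K (K ⊗[ℚ] V)) w) = (e I).1.1 w
      rw [LinearMap.zero_apply, add_zero, sub_zero]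
    · have hI : I ∈ T := Finset.mem_filter.2 ⟨Finset.mem_univ _, h1⟩
      rw [if_pos hI, h1, Units.val_neg, Units.val_one, neg_one_zsmul]
      abel
  exact ⟨MulEquiv.ofBijective f ⟨hinj, hsurj⟩, fun γ I v hv => hσ γ I v hv⟩

end SignVector

end HodgeStructure

end Literature.AlgebraicGeometry.Motives
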